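import Summits.PneNP.PneNP.Theorems.ConvexRankGatesConvexGateBlindExactLiftingTriangleInteractionSpan
import Summits.PneNP.PneNP.Theorems.ConvexRankGatesConvexGateBlindExactLiftingTriangleTwoDirBlind

/-!
# Triangle instance — THEOREM C modulo LEMMA N: factorisations by rarely-heavy atoms are large (lead c6)

Support file for crux `ConvexGateBlind` (stmt-PneNP-10680), line `xor-door-perfect-completeness`, open stub
`stub_exactLifting`; closes the logical loop of the Mono-heaviness calculus (`…TriangleMonoHeavy`,
`…TriangleTwoDirBlind`, `…TriangleInteractionSpan`, `…TriangleLineSpread`).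

* `heavySet v` = the balanced colourings at which the atom `v` is Mono-heavy; `balSet` = all balanced colourings.
* **Counting theorem** (`card_balSet_le_sum_card_heavySet`, unconditional): in any non-negative factorisation of the whole
  shifted matrix, `monoCount x w − ε = ∑_l U x l · V l w` (`U ≥ 0`, `ε > 0`, `t ≥ 1`), the heavy sets of the `D` atoms COVER the
  balanced colourings, so `#balSet ≤ ∑_l #heavySet (V l)`.  (The heavy-atom theorem, row by row.)
* **LEMMA N as a definition** (`LemmaNAt t θ`, a CONJECTURE, memo `ExactLifting-c6.md` §3–3b; never asserted): every
  non-negative interaction-free `v` has `#heavySet v ≤ θ · #balSet`.  Conjecturally it holds with `θ = 2^{−δt}`; the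
  Mono-indicators show `θ ≥ 2^{−0.78 t (1+o(1))}` is necessary.
* **THEOREM C modulo LEMMA N** (`triangle_noLift_bound_of_lemmaN`, registered form): if `LemmaNAt t θ` holds then every
  non-negative factorisation of `M_t − εJ` (`t` even `≥ 2`, any `ε > 0`) all of whose atoms are interaction-free — i.e. every
  LP relaxation of triangle-vs-cut written in the ORIGINAL edge space, without auxiliary variables — has `D · θ ≥ 1` terms'
  worth: `D ≥ 1/θ` (`= 2^{δt}` under the conjecture), uniformly in `ε`.

So the only non-formal ingredient of THEOREM C is the single inequality `LemmaNAt`.  Nothing here is cited.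
-/

set_option linter.dupNamespace false -- `Summit.PneNP.PneNP.…`: summit = sub-problem (D-0017)

namespace Summit.PneNP.PneNP.Theorems.XorDoor.TriLine.Heavy

open Finset Classical

noncomputable section

variable {t : ℕ}

/-- the balanced colourings -/
def balSet (t : ℕ) : Finset (Col t) := univ.filter fun x => Balanced x

/-- the heavy set of an atom: the balanced colourings at which it is Mono-heavy -/
def heavySet (v : Tri t → ℝ) : Finset (Col t) := univ.filter fun x => Balanced x ∧ MonoHeavy x v

/-- membership in the balanced set -/
@[simp] lemma mem_balSet {x : Col t} : x ∈ balSet t ↔ Balanced x := by simp [balSet]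

/-- membership in a heavy set -/
@[simp] lemma mem_heavySet {v : Tri t → ℝ} {x : Col t} : x ∈ heavySet v ↔ Balanced x ∧ MonoHeavy x v := by
  simp [heavySet]

/-- **Counting theorem** (unconditional): in a non-negative factorisation of the whole shifted matrix the heavy sets of the
atoms cover the balanced colourings, so `#balSet ≤ ∑_l #heavySet (V l)`. -/
theorem card_balSet_le_sum_card_heavySet (ht : 1 ≤ t) {ε : ℝ} (hε : 0 < ε) {D : ℕ}
    (U : Col t → Fin D → ℝ) (V : Fin D → Tri t → ℝ) (hU : ∀ x l, 0 ≤ U x l)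
    (hfact : ∀ x w, (monoCount x w : ℝ) - ε = ∑ l, U x l * V l w) :
    #(balSet t) ≤ ∑ l, #(heavySet (V l)) := by
  have hcover : balSet t ⊆ (univ : Finset (Fin D)).biUnion fun l => heavySet (V l) := by
    intro x hx
    rw [mem_balSet] at hx
    obtain ⟨l, -, hl⟩ := exists_monoHeavy_term ht hx hε (U x) V (hU x) (hfact x)
    exact mem_biUnion.2 ⟨l, mem_univ l, mem_heavySet.2 ⟨hx, hl⟩⟩
  exact (card_le_card hcover).trans card_biUnion_le

/-- **LEMMA N at parameter `θ`** — a CONJECTURE (memo `ExactLifting-c6.md` §3; never asserted as a theorem): every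
non-negative interaction-free function on `Tri t` is Mono-heavy at no more than a `θ`-fraction of the balanced colourings.
Conjecturally true with `θ = 2^{−δt}`; necessarily `θ ≥ 2^{−0.78t(1+o(1))}` (Mono-indicators). -/
def LemmaNAt (t : ℕ) (θ : ℝ) : Prop :=
  ∀ v : Tri t → ℝ, (∀ w, 0 ≤ v w) → InteractionFree v → (#(heavySet v) : ℝ) ≤ θ * #(balSet t)

/-- the balanced set is non-empty for even `t ≥ 2` -/
lemma balSet_nonempty (ht : 1 ≤ t) (he : Even t) : (balSet t).Nonempty := by
  obtain ⟨x, hx⟩ := exists_balanced ht he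
  exact ⟨x, mem_balSet.2 hx⟩

/-- **THEOREM C modulo LEMMA N.**  If `LemmaNAt t θ`, then every non-negative factorisation of the shifted triangle matrix
(`t` even `≥ 2`, `ε > 0`) by interaction-free atoms has `D · θ ≥ 1`. -/
theorem noLift_bound_of_lemmaN (ht : 2 ≤ t) (he : Even t) {θ : ℝ} (hN : LemmaNAt t θ) {ε : ℝ} (hε : 0 < ε) {D : ℕ}
    (U : Col t → Fin D → ℝ) (V : Fin D → Tri t → ℝ) (hU : ∀ x l, 0 ≤ U x l) (hV : ∀ l w, 0 ≤ V l w)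
    (hIF : ∀ l, InteractionFree (V l)) (hfact : ∀ x w, (monoCount x w : ℝ) - ε = ∑ l, U x l * V l w) :
    1 ≤ (D : ℝ) * θ := by
  have h1 : 1 ≤ t := le_trans (by norm_num) ht
  have hcount := card_balSet_le_sum_card_heavySet h1 hε U V hU hfact
  have hcountR : (#(balSet t) : ℝ) ≤ ∑ l, (#(heavySet (V l)) : ℝ) := by exact_mod_cast hcount
  have hsum : ∑ l, (#(heavySet (V l)) : ℝ) ≤ ∑ _l : Fin D, θ * #(balSet t) :=
    sum_le_sum fun l _ => hN (V l) (hV l) (hIF l)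
  rw [sum_const, card_univ, Fintype.card_fin, nsmul_eq_mul] at hsum
  have hpos : (0 : ℝ) < #(balSet t) := by exact_mod_cast (balSet_nonempty h1 he).card_pos
  have : (#(balSet t) : ℝ) * 1 ≤ #(balSet t) * ((D : ℝ) * θ) := by nlinarith
  exact le_of_mul_le_mul_left this hpos

/-- **THEOREM C modulo LEMMA N, registered form** (sub-goal `triangle_noLift_bound_of_lemmaN` of stmt-PneNP-10680): under
`LemmaNAt t θ`, interaction-free (no-lift) factorisations of `M_t − εJ` have at least `1/θ` terms, uniformly in `ε`. -/
theorem triangle_noLift_bound_of_lemmaN : ∀ {t : ℕ}, 2 ≤ t → Even t → ∀ {θ : ℝ}, LemmaNAt t θ → ∀ {ε : ℝ}, 0 < ε → ∀ {D : ℕ} (U : Col t → Fin D → ℝ) (V : Fin D → Tri t → ℝ), (∀ x l, 0 ≤ U x l) → (∀ l w, 0 ≤ V l w) → (∀ l, InteractionFree (V l)) → (∀ x w, (monoCount x w : ℝ) - ε = ∑ l, U x l * V l w) → 1 ≤ (D : ℝ) * θ :=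
  fun ht he _ hN _ hε _ U V hU hV hIF hfact => noLift_bound_of_lemmaN ht he hN hε U V hU hV hIF hfact

end

end Summit.PneNP.PneNP.Theorems.XorDoor.TriLine.Heavy
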